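import Literature.NumberTheory.Automorphic.ArchMultiWallCasimirStep          -- ★ (this seat): `multiWall_step_diag` (the step); brings ★ Transport (`multiWall_transport_diag`, `multiWall_base_diag`)
import Literature.NumberTheory.Automorphic.ArchRankOneCasimirLadderCayley     -- ★ (α2) Cayley frame (LH3-p01 (g4)): `exists_cayleyEquiv_diagonal`, `coe_inv_cayleyTwo`, `cayley_conj_circleDiagonal_mem_archLocal`
import HarnessLib

/-!
# The multi-wall invariant (α4-S6) on the Cayley frame `U(Φ₂)_w` — the FROZEN TEXT v4, for every finite set of wall places
# (Varadarajan 1989 §6.4 Thms 22–24; Bouaziz 1994 §3.1 (I₂); Rogawski 1990 §8.2 pp. 119–123; Hörmander Thm. 1.1.9)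

Topic `NumberTheory/Automorphic`.  THEOREMS ONLY (no `def`, no instance, no notation, no axiom, no named fact, no `sorry`); kernel lane `--kind proof --supports stmt-HodgeConjecture-24833`.
Cell `pub/hodgecm-mathlib`, crux H413 (`stmt-HodgeConjecture-24833`), line LH3 (closer stub `stub_N9`, direct road), letter L3′ organ O-L3′ (ii), (α4) «all-orders transport», stage
**(α4-S6) «MULTI-WALL base points»** (LH3-plan (g3) 2026-09-02T10:09Z; frozen invariant v4 `F0/P3c/LH10/LH10-p01/g4/s6/MultiWallInvFrozen.v4.LH10p01g4.lean`, adopted byte-for-byte by the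
(S7) consumer LH3-p01 (g5) 10:55Z).  Seat LH10-p01 (g4).  Count-neutral.
Brick (S6-B6).  Namespace `Literature.NumberTheory.Automorphic.RankOneCasimir`.

* §1 **`multiWall_inv_diag`**: `Fintype.induction_empty_option` over ★ `multiWall_base_diag`, ★ `multiWall_transport_diag` and ★ `multiWall_step_diag` ⇒ the invariant for EVERY
  `Fintype ι` in the diagonal frame `U(σ_w diag(2,−2))(ℂ)`.
* §2 **`multiWall_inv`** concludes, for EVERY `(ι : Type) [Fintype ι] (wl) (z) [MeasurableSpace] [BorelSpace] (ν) [IsHaarMeasure] [IsMulRightInvariant]`, LITERALLY the body of the frozen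
reference `MultiWallInvFrozen L wl z ν` (HOME file above; the (S7) consumer takes it as `(hInv : …)` with `ι := ↥P₀`, `wl := Subtype.val`, `z := fun _ => 1`): the JOINT `(ψ, v)`-jets
of `(ψ, v) ↦ (∏ 2 sin ψ_i) • ∫_{Π U(Φ₂)_{wl i}} Φ (v, (↑↑(h_i · P t_{z_i}(ψ_i) P⁻¹ · h_i⁻¹))_i) d(⊗ν)` are bounded on the open signed unit cube times any compact `KV`, for every
finite-dimensional slot `V`, Banach `E`, jointly smooth compactly `Y`-supported `Φ`, order `n`, sign vector `ε`.  PROOF: ★ `multiWall_inv_diag` for the transported data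
`Φ^P (v, Y) = Φ (v, (P Y_i P⁻¹)_i)`, `μ_i = ν_i ∘ e_i` along the Cayley congruences `e_i : U(σ diag(2,−2)) ≃ₜ* U(Φ₂)` (★ `exists_cayleyEquiv_diagonal`, place by place; ★
`integral_pi_comp_piCongrRight`): the torus points move with the frame (`⟨P t P⁻¹, _⟩ = e_i ⟨t, _⟩`), so both frames define THE SAME function of `(ψ, v)`.
HONEST LABEL: HC_CM is proved only modulo the 7 printed citations (2 remaining: hLiu418 = `stmt-HodgeConjecture-24832`, h413 = `stmt-HodgeConjecture-24833`) until rung 0 closes;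
bookkeeping over ★ engines, count-neutral, pays nothing by itself.

## References
* [Varadarajan1989] V. S. Varadarajan, *An Introduction to Harmonic Analysis on Semisimple Lie Groups* (1989), §6.4 Thms 22–24.
* [Bouaziz1994IntegralesOrbitales] A. Bouaziz, *Intégrales orbitales sur les groupes de Lie réductifs*, Ann. Sci. ÉNS 27 (1994), §3.1 (I₁)–(I₂) p. 579.
* [HormanderALPDO1] L. Hörmander, *The Analysis of Linear Partial Differential Operators I*, 2nd ed. (1990), §1.1 Thm. 1.1.9, §2.1.
* [Rogawski1990] J. D. Rogawski, *Automorphic Representations of Unitary Groups in Three Variables*, Ann. of Math. Stud. 123 (1990), §8.2 pp. 119–123.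
-/

set_option autoImplicit false

noncomputable section

namespace Literature.NumberTheory.Automorphic.RankOneCasimir

open _root_.Complex _root_.Matrix _root_.MeasureTheory _root_.Set _root_.Filter _root_.Topology _root_.NumberField _root_.NumberField.InfinitePlace
open _root_.Literature.NumberTheory.Automorphic _root_.Literature.NumberTheory.Automorphic.UnitaryGroup _root_.Literature.Analysis.Calculus
open scoped Matrix.Norms.Operator MatrixGroups ComplexConjugate ContDiff Real

/-! ## §1 The induction: the invariant for every finite set of wall places (diagonal frame) -/

section Induction

variable (L : Type) [Field L] [NumberField L]

/-- **THE MULTI-WALL INVARIANT IN THE DIAGONAL FRAME, FOR EVERY FINITE SET OF WALL PLACES** (`Fintype.induction_empty_option` over ★ base, ★ transport, ★ step): for every `Fintype ι`,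
complex places `wl`, centres `z`, Haar right-invariant `ν_i` on `U(σ_w diag(2,−2))(ℂ)`, every finite-dimensional slot `V`, Banach `E`, jointly smooth `Φ` with one compact `Y`-support
uniform in `v ∈ V`, compact `KV`, order `n` and sign vector `ε`: the joint `(ψ, v)`-jets of `(∏ 2 sin ψ_i) • ∫ Φ (v, (↑↑(h_i t_i(ψ_i) h_i⁻¹))_i) d(⊗ν)` are bounded on the open signed
unit cube times `KV`. [cite: Varadarajan1989, §6.4 Thms 22–24] [cite: Bouaziz1994IntegralesOrbitales, §3.1 (I₂) p. 579] [cite: Rogawski1990, §8.2 pp. 122–123] -/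
theorem multiWall_inv_diag (ι : Type) [Fintype ι] (wl : ι → {w : InfinitePlace L // IsComplex w}) (z : ι → Circle)
    [∀ i, MeasurableSpace (unitaryGroupOfForm (starRingEnd ℂ) ((Matrix.diagonal ![(2 : L), -2]).map (wl i).1.embedding))] [∀ i, BorelSpace (unitaryGroupOfForm (starRingEnd ℂ) ((Matrix.diagonal ![(2 : L), -2]).map (wl i).1.embedding))]
    (ν : ∀ i, Measure (unitaryGroupOfForm (starRingEnd ℂ) ((Matrix.diagonal ![(2 : L), -2]).map (wl i).1.embedding))) [∀ i, (ν i).IsHaarMeasure] [∀ i, (ν i).IsMulRightInvariant] :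
    ∀ (V : Type) [NormedAddCommGroup V] [NormedSpace ℝ V] [FiniteDimensional ℝ V] (E : Type) [NormedAddCommGroup E] [NormedSpace ℝ E] [CompleteSpace E]
      (Φ : V × (ι → Matrix (Fin 2) (Fin 2) ℂ) → E) (_hΦ : ContDiff ℝ ∞ Φ) (KV : Set V) (_hKV : IsCompact KV)
      (K : Set (ι → Matrix (Fin 2) (Fin 2) ℂ)) (_hK : IsCompact K) (_h0 : ∀ (v : V) (Y : ι → Matrix (Fin 2) (Fin 2) ℂ), Y ∉ K → Φ (v, Y) = 0)
      (F : (ι → ℝ) × V → E) (_hF : ∀ x : (ι → ℝ) × V, F x = (∏ i, 2 * Real.sin (x.1 i)) •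
        ∫ h : (∀ i : ι, unitaryGroupOfForm (starRingEnd ℂ) ((Matrix.diagonal ![(2 : L), -2]).map (wl i).1.embedding)), Φ (x.2, fun i => (((h i * ⟨circleDiagonal 2 ![z i * Circle.exp (x.1 i), z i * Circle.exp (-(x.1 i))], circleDiagonal_mem_archLocal_diagonal L 2 ![(2 : L), -2] (wl i) _⟩ * (h i)⁻¹ : unitaryGroupOfForm (starRingEnd ℂ) ((Matrix.diagonal ![(2 : L), -2]).map (wl i).1.embedding)) : GL (Fin 2) ℂ) : Matrix (Fin 2) (Fin 2) ℂ)) ∂(Measure.pi ν))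
      (n : ℕ) (ε : ι → Bool),
      ∃ B : ℝ, ∀ ψ : ι → ℝ, (∀ i, 0 < (if ε i then ψ i else -ψ i) ∧ (if ε i then ψ i else -ψ i) < 1) → ∀ v ∈ KV, ‖iteratedFDeriv ℝ n F (ψ, v)‖ ≤ B := by
  revert ν z wl
  refine Fintype.induction_empty_option
    (P := fun (ι : Type) [Fintype ι] => ∀ (wl : ι → {w : InfinitePlace L // IsComplex w}) (z : ι → Circle)
      [∀ i, MeasurableSpace (unitaryGroupOfForm (starRingEnd ℂ) ((Matrix.diagonal ![(2 : L), -2]).map (wl i).1.embedding))] [∀ i, BorelSpace (unitaryGroupOfForm (starRingEnd ℂ) ((Matrix.diagonal ![(2 : L), -2]).map (wl i).1.embedding))]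
      (ν : ∀ i, Measure (unitaryGroupOfForm (starRingEnd ℂ) ((Matrix.diagonal ![(2 : L), -2]).map (wl i).1.embedding))) [∀ i, (ν i).IsHaarMeasure] [∀ i, (ν i).IsMulRightInvariant],
      ∀ (V : Type) [NormedAddCommGroup V] [NormedSpace ℝ V] [FiniteDimensional ℝ V] (E : Type) [NormedAddCommGroup E] [NormedSpace ℝ E] [CompleteSpace E]
      (Φ : V × (ι → Matrix (Fin 2) (Fin 2) ℂ) → E) (_hΦ : ContDiff ℝ ∞ Φ) (KV : Set V) (_hKV : IsCompact KV)
      (K : Set (ι → Matrix (Fin 2) (Fin 2) ℂ)) (_hK : IsCompact K) (_h0 : ∀ (v : V) (Y : ι → Matrix (Fin 2) (Fin 2) ℂ), Y ∉ K → Φ (v, Y) = 0)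
      (F : (ι → ℝ) × V → E) (_hF : ∀ x : (ι → ℝ) × V, F x = (∏ i, 2 * Real.sin (x.1 i)) •
        ∫ h : (∀ i : ι, unitaryGroupOfForm (starRingEnd ℂ) ((Matrix.diagonal ![(2 : L), -2]).map (wl i).1.embedding)), Φ (x.2, fun i => (((h i * ⟨circleDiagonal 2 ![z i * Circle.exp (x.1 i), z i * Circle.exp (-(x.1 i))], circleDiagonal_mem_archLocal_diagonal L 2 ![(2 : L), -2] (wl i) _⟩ * (h i)⁻¹ : unitaryGroupOfForm (starRingEnd ℂ) ((Matrix.diagonal ![(2 : L), -2]).map (wl i).1.embedding)) : GL (Fin 2) ℂ) : Matrix (Fin 2) (Fin 2) ℂ)) ∂(Measure.pi ν))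
      (n : ℕ) (ε : ι → Bool),
      ∃ B : ℝ, ∀ ψ : ι → ℝ, (∀ i, 0 < (if ε i then ψ i else -ψ i) ∧ (if ε i then ψ i else -ψ i) < 1) → ∀ v ∈ KV, ‖iteratedFDeriv ℝ n F (ψ, v)‖ ≤ B)
    (fun α β _ e hα wl z _ _ ν _ _ => ?_) (fun wl z _ _ ν _ _ => multiWall_base_diag L wl z ν) (fun α _ hα wl z _ _ ν _ _ => ?_) ι
  · letI : Fintype α := Fintype.ofEquiv β e.symm
    exact multiWall_transport_diag L e wl z ν (hα (fun a => wl (e a)) (fun a => z (e a)) (fun a => ν (e a)))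
  · exact multiWall_step_diag L wl z ν (hα (fun i => wl (some i)) (fun i => z (some i)) (fun i => ν (some i)))

end Induction

/-! ## §2 The Cayley transport: the FROZEN TEXT v4 on `U(Φ₂)_w` -/

section Cayley

variable (L : Type) [Field L] [NumberField L]

/-- Right invariance passes along a measurable multiplicative equivalence. [folklore] -/
private theorem isMulRightInvariant_map_mulEquiv₃ {A B : Type*} [Group A] [Group B] [MeasurableSpace A] [MeasurableSpace B]
    [MeasurableMul A] [MeasurableMul B] (f : A ≃* B) (hf : Measurable f) (μ : Measure A) [μ.IsMulRightInvariant] :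
    (Measure.map f μ).IsMulRightInvariant := by
  -- adapted from ★ `ArchRankOneCasimirLadderCayley` (private `isMulRightInvariant_map_mulEquiv''`)
  refine ⟨fun b => ?_⟩
  obtain ⟨a, rfl⟩ := f.surjective b
  rw [Measure.map_map (measurable_mul_const (f a)) hf]
  have h1 : (fun x => x * f a) ∘ ⇑f = ⇑f ∘ fun x => x * a := by
    funext x; simp only [Function.comp_apply, map_mul]
  rw [h1, ← Measure.map_map hf (measurable_mul_const a), map_mul_right_eq_self μ a]

/-- **THE MULTI-WALL INVARIANT (α4-S6), FROZEN TEXT v4** — on the Cayley frame `U(Φ₂)_{wl i}` of the (S7) consumer, for EVERY finite index type `ι` of wall places, complex places `wl`,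
centres `z`, Haar right-invariant `ν_i`: for every finite-dimensional smooth slot `V`, Banach `E`, jointly smooth `Φ : V × (ι → M₂(ℂ)) → E` with one compact matrix support `K` uniform in
`v`, compact `KV ⊆ V`, order `n` and sign vector `ε`, the JOINT `(ψ, v)`-jets of `(ψ, v) ↦ (∏ 2 sin ψ_i) • ∫_{Π U(Φ₂)} Φ (v, (↑↑(h_i · P t_{z_i}(ψ_i) P⁻¹ · h_i⁻¹))_i) d(⊗ν)` are bounded on
the open signed unit cube `{0 < ±ψ_i < 1} × KV`.  (★ `multiWall_inv_diag` in the diagonal frame for the transported data `Φ^P (v, Y) = Φ (v, (P Y_i P⁻¹)_i)`, `μ_i = ν_i ∘ e_i`, the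
Cayley congruences `e_i : U(σ diag(2,−2)) ≃ₜ* U(Φ₂)` ★ `exists_cayleyEquiv_diagonal` place by place, ★ `integral_pi_comp_piCongrRight`: the torus points move with the frame, so both
frames define THE SAME function of `(ψ, v)`.) [cite: Varadarajan1989, §6.4 Thms 22–24] [cite: Bouaziz1994IntegralesOrbitales, §3.1 (I₂) p. 579] [cite: Rogawski1990, §8.2 pp. 119–123]
[cite: HormanderALPDO1, §1.1 Thm. 1.1.9] -/
theorem multiWall_inv (ι : Type) [Fintype ι] (wl : ι → {w : InfinitePlace L // IsComplex w}) (z : ι → Circle)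
    [∀ i, MeasurableSpace ↥(archLocal L 2 (Matrix.of fun i j : Fin 2 => if i.val + j.val + 1 = 2 then (1 : L) else 0) (wl i))] [∀ i, BorelSpace ↥(archLocal L 2 (Matrix.of fun i j : Fin 2 => if i.val + j.val + 1 = 2 then (1 : L) else 0) (wl i))]
    (ν : ∀ i, Measure ↥(archLocal L 2 (Matrix.of fun i j : Fin 2 => if i.val + j.val + 1 = 2 then (1 : L) else 0) (wl i))) [∀ i, (ν i).IsHaarMeasure] [∀ i, (ν i).IsMulRightInvariant] :
    ∀ (V : Type) [NormedAddCommGroup V] [NormedSpace ℝ V] [FiniteDimensional ℝ V]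
      (E : Type) [NormedAddCommGroup E] [NormedSpace ℝ E] [CompleteSpace E]
      (Φ : V × (ι → Matrix (Fin 2) (Fin 2) ℂ) → E) (hΦ : ContDiff ℝ ∞ Φ)
      (KV : Set V) (hKV : IsCompact KV) (K : Set (ι → Matrix (Fin 2) (Fin 2) ℂ)) (hK : IsCompact K)
      (h0 : ∀ (v : V) (Y : ι → Matrix (Fin 2) (Fin 2) ℂ), Y ∉ K → Φ (v, Y) = 0) (n : ℕ) (ε : ι → Bool),
      ∃ B : ℝ, ∀ ψ : ι → ℝ, (∀ i, 0 < (if ε i then ψ i else -ψ i) ∧ (if ε i then ψ i else -ψ i) < 1) → ∀ v ∈ KV,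
        ‖iteratedFDeriv ℝ n (fun x : (ι → ℝ) × V => (∏ i, 2 * Real.sin (x.1 i)) •
            ∫ h : (∀ i, ↥(archLocal L 2 (Matrix.of fun i j : Fin 2 => if i.val + j.val + 1 = 2 then (1 : L) else 0) (wl i))),
              Φ (x.2, fun i => (((h i * ⟨Matrix.GeneralLinearGroup.mkOfDetNeZero !![(1 : ℂ), 1; 1, -1] det_cayleyTwo_ne_zero *
                      circleDiagonal 2 ![z i * Circle.exp (x.1 i), z i * Circle.exp (-(x.1 i))] *
                      (Matrix.GeneralLinearGroup.mkOfDetNeZero !![(1 : ℂ), 1; 1, -1] det_cayleyTwo_ne_zero)⁻¹,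
                    cayley_conj_circleDiagonal_mem_archLocal L (wl i) _⟩ * (h i)⁻¹ :
                  ↥(archLocal L 2 (Matrix.of fun i j : Fin 2 => if i.val + j.val + 1 = 2 then (1 : L) else 0) (wl i))) : GL (Fin 2) ℂ) :
                Matrix (Fin 2) (Fin 2) ℂ)) ∂(Measure.pi ν)) (ψ, v)‖ ≤ B := by
  intro V _ _ _ E _ _ _ Φ hΦ KV hKV K hK h0 n ε
  -- the Cayley congruence at every place, the transported Haar measures on the diagonal frame
  choose e he using fun i => exists_cayleyEquiv_diagonal L (wl i)
  letI : ∀ i, MeasurableSpace (unitaryGroupOfForm (starRingEnd ℂ) ((Matrix.diagonal ![(2 : L), -2]).map (wl i).1.embedding)) := fun i => borel _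
  haveI : ∀ i, BorelSpace (unitaryGroupOfForm (starRingEnd ℂ) ((Matrix.diagonal ![(2 : L), -2]).map (wl i).1.embedding)) := fun i => ⟨rfl⟩
  haveI : ∀ i, ((ν i).map ⇑(e i).symm).IsHaarMeasure := fun i => (e i).symm.isHaarMeasure_map (ν i)
  haveI : ∀ i, ((ν i).map ⇑(e i).symm).IsMulRightInvariant := fun i =>
    isMulRightInvariant_map_mulEquiv₃ (e i).symm.toMulEquiv (e i).symm.continuous.measurable (ν i)
  -- the Cayley matrices
  have hAB : (!![(1 : ℂ), 1; 1, -1] : Matrix (Fin 2) (Fin 2) ℂ) * (!![(1 / 2 : ℂ), 1 / 2; 1 / 2, -(1 / 2)] : Matrix (Fin 2) (Fin 2) ℂ) = 1 := by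
    ext i j; fin_cases i <;> fin_cases j <;> simp [Matrix.mul_apply, Fin.sum_univ_two] <;> norm_num
  have hBA : (!![(1 / 2 : ℂ), 1 / 2; 1 / 2, -(1 / 2)] : Matrix (Fin 2) (Fin 2) ℂ) * (!![(1 : ℂ), 1; 1, -1] : Matrix (Fin 2) (Fin 2) ℂ) = 1 := by
    ext i j; fin_cases i <;> fin_cases j <;> simp [Matrix.mul_apply, Fin.sum_univ_two] <;> norm_num
  -- the transported family on the diagonal frame
  obtain ⟨ΦP, hΦP⟩ : ∃ ΦP : V × (ι → Matrix (Fin 2) (Fin 2) ℂ) → E, ∀ p, ΦP p = Φ (p.1, fun i => (!![(1 : ℂ), 1; 1, -1] : Matrix (Fin 2) (Fin 2) ℂ) * p.2 i * (!![(1 / 2 : ℂ), 1 / 2; 1 / 2, -(1 / 2)] : Matrix (Fin 2) (Fin 2) ℂ)) := ⟨_, fun _ => rfl⟩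
  have hΦPd : ContDiff ℝ ∞ ΦP := by
    rw [show ΦP = fun p => Φ (p.1, fun i => (!![(1 : ℂ), 1; 1, -1] : Matrix (Fin 2) (Fin 2) ℂ) * p.2 i * (!![(1 / 2 : ℂ), 1 / 2; 1 / 2, -(1 / 2)] : Matrix (Fin 2) (Fin 2) ℂ)) from funext hΦP]
    exact hΦ.comp (contDiff_fst.prodMk (contDiff_pi.2 fun i =>
      (contDiff_const.mul ((contDiff_apply ℝ (Matrix (Fin 2) (Fin 2) ℂ) i).comp contDiff_snd)).mul contDiff_const))
  have hKP : IsCompact ((fun Y : ι → Matrix (Fin 2) (Fin 2) ℂ => fun i => (!![(1 / 2 : ℂ), 1 / 2; 1 / 2, -(1 / 2)] : Matrix (Fin 2) (Fin 2) ℂ) * Y i * (!![(1 : ℂ), 1; 1, -1] : Matrix (Fin 2) (Fin 2) ℂ)) '' K) :=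
    hK.image (continuous_pi fun i => (continuous_const.mul (continuous_apply i)).mul continuous_const)
  have h0P : ∀ (v : V) (Y : ι → Matrix (Fin 2) (Fin 2) ℂ), Y ∉ (fun Y : ι → Matrix (Fin 2) (Fin 2) ℂ => fun i => (!![(1 / 2 : ℂ), 1 / 2; 1 / 2, -(1 / 2)] : Matrix (Fin 2) (Fin 2) ℂ) * Y i * (!![(1 : ℂ), 1; 1, -1] : Matrix (Fin 2) (Fin 2) ℂ)) '' K → ΦP (v, Y) = 0 := by
    intro v Y hY
    rw [hΦP]
    refine h0 _ _ fun hW => hY ⟨_, hW, ?_⟩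
    funext i
    show (!![(1 / 2 : ℂ), 1 / 2; 1 / 2, -(1 / 2)] : Matrix (Fin 2) (Fin 2) ℂ) * ((!![(1 : ℂ), 1; 1, -1] : Matrix (Fin 2) (Fin 2) ℂ) * Y i * (!![(1 / 2 : ℂ), 1 / 2; 1 / 2, -(1 / 2)] : Matrix (Fin 2) (Fin 2) ℂ)) * (!![(1 : ℂ), 1; 1, -1] : Matrix (Fin 2) (Fin 2) ℂ) = Y i
    rw [← Matrix.mul_assoc, ← Matrix.mul_assoc, hBA, Matrix.one_mul, Matrix.mul_assoc, hBA, Matrix.mul_one]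
  -- the torus point moves with the frame, and so does every conjugate
  have hconj : ∀ (i : ι) (g : unitaryGroupOfForm (starRingEnd ℂ) ((Matrix.diagonal ![(2 : L), -2]).map (wl i).1.embedding)) (ψ : ℝ), ((((e i) g * (⟨Matrix.GeneralLinearGroup.mkOfDetNeZero !![(1 : ℂ), 1; 1, -1] det_cayleyTwo_ne_zero * circleDiagonal 2 ![z i * Circle.exp (ψ), z i * Circle.exp (-(ψ))] * (Matrix.GeneralLinearGroup.mkOfDetNeZero !![(1 : ℂ), 1; 1, -1] det_cayleyTwo_ne_zero)⁻¹, cayley_conj_circleDiagonal_mem_archLocal L (wl i) _⟩ : ↥(archLocal L 2 (Matrix.of fun i j : Fin 2 => if i.val + j.val + 1 = 2 then (1 : L) else 0) (wl i))) * ((e i) g)⁻¹ : ↥(archLocal L 2 (Matrix.of fun i j : Fin 2 => if i.val + j.val + 1 = 2 then (1 : L) else 0) (wl i))) : GL (Fin 2) ℂ) : Matrix (Fin 2) (Fin 2) ℂ) = (!![(1 : ℂ), 1; 1, -1] : Matrix (Fin 2) (Fin 2) ℂ) * (((g * ⟨circleDiagonal 2 ![z i * Circle.exp (ψ), z i * Circle.exp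 (-(ψ))], circleDiagonal_mem_archLocal_diagonal L 2 ![(2 : L), -2] (wl i) _⟩ * (g)⁻¹ : unitaryGroupOfForm (starRingEnd ℂ) ((Matrix.diagonal ![(2 : L), -2]).map (wl i).1.embedding)) : GL (Fin 2) ℂ) : Matrix (Fin 2) (Fin 2) ℂ) * (!![(1 / 2 : ℂ), 1 / 2; 1 / 2, -(1 / 2)] : Matrix (Fin 2) (Fin 2) ℂ) := by
    intro i g ψ
    have hγ : (⟨Matrix.GeneralLinearGroup.mkOfDetNeZero !![(1 : ℂ), 1; 1, -1] det_cayleyTwo_ne_zero * circleDiagonal 2 ![z i * Circle.exp (ψ), z i * Circle.exp (-(ψ))] * (Matrix.GeneralLinearGroup.mkOfDetNeZero !![(1 : ℂ), 1; 1, -1] det_cayleyTwo_ne_zero)⁻¹, cayley_conj_circleDiagonal_mem_archLocal L (wl i) _⟩ : ↥(archLocal L 2 (Matrix.of fun i j : Fin 2 => if i.val + j.val + 1 = 2 then (1 : L) else 0) (wl i))) = e i ⟨circleDiagonal 2 ![z i * Circle.exp ψ, z i * Circle.exp (-ψ)], circleDiagonal_mem_archLocal_diagonal L 2 ![(2 :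 L), -2] (wl i) _⟩ :=
      Subtype.ext (he i ⟨circleDiagonal 2 ![z i * Circle.exp ψ, z i * Circle.exp (-ψ)], circleDiagonal_mem_archLocal_diagonal L 2 ![(2 : L), -2] (wl i) _⟩).symm
    rw [hγ, ← map_inv, ← map_mul, ← map_mul, he i, Units.val_mul, Units.val_mul, Matrix.GeneralLinearGroup.val_mkOfDetNeZero, coe_inv_cayleyTwo]
  -- factorwise measure transport
  have hφ : ∀ i, MeasurePreserving ((e i).toHomeomorph.toMeasurableEquiv) ((ν i).map ⇑(e i).symm) (ν i) := fun i =>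
    ⟨(e i).toHomeomorph.toMeasurableEquiv.measurable, (e i).toHomeomorph.toMeasurableEquiv.map_map_symm⟩
  haveI : ∀ i, SecondCountableTopology ↥(archLocal L 2 (Matrix.of fun i j : Fin 2 => if i.val + j.val + 1 = 2 then (1 : L) else 0) (wl i)) := fun i =>
    secondCountableTopology_archLocal L 2 (Matrix.of fun i j : Fin 2 => if i.val + j.val + 1 = 2 then (1 : L) else 0) (wl i)
  haveI : ∀ i, LocallyCompactSpace ↥(archLocal L 2 (Matrix.of fun i j : Fin 2 => if i.val + j.val + 1 = 2 then (1 : L) else 0) (wl i)) := fun i =>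
    locallyCompactSpace_archLocal L 2 (Matrix.of fun i j : Fin 2 => if i.val + j.val + 1 = 2 then (1 : L) else 0) (wl i)
  -- ★ the diagonal-frame invariant for the transported data, with `F :=` THE CAYLEY-FRAME FUNCTION (same function of `(ψ, v)`)
  exact multiWall_inv_diag L ι wl z (fun i => (ν i).map ⇑(e i).symm) V E ΦP hΦPd KV hKV _ hKP h0P _ (fun x => by
    congr 1
    rw [Literature.MeasureTheory.Constructions.integral_pi_comp_piCongrRight (fun i => (ν i).map ⇑(e i).symm) ν
      (fun i => (e i).toHomeomorph.toMeasurableEquiv) hφ]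
    refine integral_congr_ae (Eventually.of_forall fun y => ?_)
    dsimp only
    rw [hΦP]
    congr 1
    refine congrArg (Prod.mk x.2) (funext fun i => ?_)
    rw [Homeomorph.toMeasurableEquiv_coe]
    exact hconj i (y i) (x.1 i)) n ε

end Cayley

end Literature.NumberTheory.Automorphic.RankOneCasimir

end
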